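import Literature.Claims.NS.ClayR3SupBlowupCertificate
import Literature.Analysis.FluidPDE.ClassicalNSBlowupAlternative
import HarnessLib

/-!
# Clay (A)/(C) reference — the blow-up alternative for Clay data: (A)-solvability of one Cauchy
# problem FAILS iff its smooth finite-energy solution blows up in sup norm in finite time; (A) ⇔ an
# a priori `L^∞` bound in the finite-energy classical class

Companion to `ClayR3HorizonBridge.lean` ((A) ⇔ a smooth finite-energy solution on every closed slab)
and `ClayR3SupBlowupCertificate.lean` (a sup-norm blow-up of a finite-energy classical solution on
`[0, T)` excludes (A)-solvability). With the tree's blow-up alternative for smooth finite-energy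
solutions on `ℝ³` (`Literature.Analysis.FluidPDE.finiteEnergy_classical_dichotomy`: Leray 1934 §33 /
Robinson–Rodrigo–Sadowski Thm. 8.17 / Tao 2013 Thm. 5.4 + Cor. 11.1 + Cor. 11.4, assembled from tree
theorems) the certificate becomes an EQUIVALENCE, and Clay (A) becomes an a priori bound:

* `clayR3_solvable_or_supBlowup` — for `μ > 0` and a smooth divergence-free datum of class (4):
  EITHER `(μ, 0, u₀)` is Clay-solvable ((1)–(3), (6), (7) on `ℝ³ × [0,∞)`), OR there are
  `0 < T* < ∞` and a classical solution on `[0, T*) × ℝ³` from `u₀`, with energy bounded on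
  `[0, T*)`, whose velocity is unbounded on `[0, T*) × ℝ³`, and no closed slab `[0, T]`, `T ≥ T*`,
  carries a finite-energy classical solution from `u₀`;
* `not_clayR3_solvable_iff_exists_supBlowup` — `(μ, 0, u₀)` is NOT Clay-solvable ⇔ some
  finite-energy classical solution from `u₀` on a half-open slab has unbounded velocity (the
  certificate of `ClayR3SupBlowupCertificate.lean` is the ONLY way (A)-solvability fails);
* `clayR3_regularityAt_iff_aprioriBound` / `clayR3_regularity_iff_aprioriBound` — **(A) ⇔ the
  qualitative a priori bound**: every finite-energy classical solution of the unforced system on a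
  half-open slab `[0, T) × ℝ³` from a smooth divergence-free datum of class (4) is BOUNDED there
  (one viscosity ⇔ every viscosity, by the Δ7 scaling `clayR3_regularityAt_iff`);
* `navierStokesBreakdownR3_iff_exists_supBlowup` — the UNFORCED instance of (C) in blow-up form:
  `(∃ μ > 0, ∃ u₀ of class (4), ¬ Solvable μ 0 u₀) ↔ (∃ μ > 0, ∃ u₀ of class (4), ∃ T*, a
  finite-energy classical solution on [0, T*) from u₀ with unbounded velocity)`, either side
  proving the leaf `NavierStokesBreakdownR3` (`navierStokesBreakdownR3_of_exists_supBlowup`; the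
  printed (C) also admits forced counterexamples, which this file does not touch).

Usage on a CARD (§3): a REG claim printed as an a priori estimate «every smooth finite-energy
solution stays bounded (in `L^∞`) on its interval of existence» for class-(4) data IS (A) by
`clayR3_regularity_iff_aprioriBound` — no Δ6 delta (the «local existence + continuation» prose is
supplied by the tree); what stays a delta is the solution class over which the bound is asserted
(rapid decay of every slice, periodicity, no energy hypothesis: Δ4/Δ5) and bounds on quantities other
than `|u|` (vorticity/gradient bounds need the BKM step, not in this file). A NEG claim printed as
«the solution from `u₀` blows up at `T*`» is (C) exactly when the blow-up is of a finite-energy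
classical solution in sup norm (or any `Dⁿu`, `ClayR3SupBlowupCertificate`).

## References

* C. L. Fefferman, *Existence and smoothness of the Navier–Stokes equation*, CMI 2006, (A), (C) with
  (4)–(7) p. 2. [FeffermanClay2006]
* J. Leray, Acta Math. 63 (1934), §33. [Leray1934]
* T. Tao, Anal. PDE 6 (2013) = arXiv:1108.1165: Def. 1.1, Conj. 1.3, Thm. 5.4, Lemma 8.1, Cor. 11.1,
  Cor. 11.4. [Tao2013Localisation] (proofs-file key `Tao2011`)
* J. C. Robinson, J. L. Rodrigo, W. Sadowski, CUP 2016, Thm. 8.17, proof of Thm. 12.3.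
  [RobinsonRodrigoSadowski2016]

WHAT THIS IS NOT: not a claim about NS regularity or blow-up; not a claim about any author beyond
the typed locator.
-/

open scoped ContDiff ENNReal NNReal Topology

namespace Literature.Claims.NS.ClayVariants

open Set Filter MeasureTheory Function Literature.Analysis Literature.Analysis.FluidPDE

noncomputable section

variable {μ : ℝ} {u₀ : EuclideanSpace ℝ (Fin 3) → EuclideanSpace ℝ (Fin 3)}

/-- Clay data (4) are `H^∞` data: every derivative of a rapidly decaying smooth field is in `L²`
(tree lemma `HasRapidSpatialDecay.lintegral_enorm_iteratedFDeriv_sq_lt_top`).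
[cite: FeffermanClay2006, (4) p. 1] [cite: Tao2011, §1 p. 3] -/
theorem sobolevDatum_of_rapidDecay (hdec : HasRapidSpatialDecay u₀) (n : ℕ) :
    ∫⁻ x, ‖iteratedFDeriv ℝ n u₀ x‖ₑ ^ 2 < ⊤ :=
  hdec.lintegral_enorm_iteratedFDeriv_sq_lt_top (μ := volume) n

/-- **The blow-up alternative for one Clay Cauchy problem.** Let `μ > 0` and `u₀` smooth, divergence
free, of class (4). EITHER `(μ, 0, u₀)` is Clay-solvable, OR there are `T* > 0` and a classical
solution `(u, p)` of the unforced system on `[0, T*) × ℝ³` with `u 0 = u₀`, energy bounded on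
`[0, T*)`, velocity UNBOUNDED on `[0, T*) × ℝ³`, and such that no closed slab `[0, T]`, `T ≥ T*`,
carries a finite-energy classical solution from `u₀` (tree theorem
`finiteEnergy_classical_dichotomy` + the horizon bridge `clayR3_solvable_zero_iff_forall_Icc_of_rapidDecay`).
[cite: FeffermanClay2006, (A) with (4) (6) (7) p. 2] [cite: Leray1934, §33] [cite: Tao2011, Thm. 5.4, Lemma 8.1, Cor. 11.1, Cor. 11.4] -/
theorem clayR3_solvable_or_supBlowup (hμ : 0 < μ) (hu₀ : ContDiff ℝ ∞ u₀)
    (hdiv : NSWave0.IsDivFree u₀) (hdec : HasRapidSpatialDecay u₀) :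
    clayR3.Solvable μ 0 u₀ ∨
      ∃ Ts : ℝ, 0 < Ts ∧
        ∃ (u : ℝ → EuclideanSpace ℝ (Fin 3) → EuclideanSpace ℝ (Fin 3))
          (p : ℝ → EuclideanSpace ℝ (Fin 3) → ℝ),
          IsClassicalNSSolutionOn (Ico 0 Ts) μ 0 u p ∧ u 0 = u₀ ∧
          (∃ A : ℝ≥0∞, A < ⊤ ∧ ∀ t ∈ Ico 0 Ts, ∫⁻ x, ‖u t x‖ₑ ^ 2 ≤ A) ∧
          (∀ M : ℝ, ∃ t ∈ Ico 0 Ts, ∃ x, M < ‖u t x‖) ∧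
          ∀ T : ℝ, Ts ≤ T →
            ∀ (w : ℝ → EuclideanSpace ℝ (Fin 3) → EuclideanSpace ℝ (Fin 3))
              (q : ℝ → EuclideanSpace ℝ (Fin 3) → ℝ),
              IsClassicalNSSolutionOn (Icc 0 T) μ 0 w q → w 0 = u₀ →
                ¬ ∃ A : ℝ≥0∞, A < ⊤ ∧ ∀ t ∈ Icc 0 T, ∫⁻ x, ‖w t x‖ₑ ^ 2 ≤ A := by
  rcases finiteEnergy_classical_dichotomy hμ hu₀ hdiv (sobolevDatum_of_rapidDecay hdec) with
    hall | hblow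
  · exact Or.inl
      ((clayR3_solvable_zero_iff_forall_Icc_of_rapidDecay hμ (hu₀.of_le (by norm_cast)) hdec).2 hall)
  · exact Or.inr hblow

/-- **(A)-solvability of one Cauchy problem fails iff its smooth finite-energy solution blows up in
sup norm in finite time**: for `μ > 0` and `u₀` smooth divergence free of class (4),
`¬ clayR3.Solvable μ 0 u₀ ↔ ∃ T > 0, ∃ (u, p)` classical on `[0, T) × ℝ³`, `u 0 = u₀`, finite energy on
`[0, T)`, `|u|` unbounded on `[0, T) × ℝ³` ((⇐) is `not_clayR3_solvable_of_velocitySupCertificate`).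
[cite: FeffermanClay2006, (A) (C) with (4)–(7) p. 2] [cite: Leray1934, §33] [cite: Tao2011, Cor. 11.1, Cor. 11.4] -/
theorem not_clayR3_solvable_iff_exists_supBlowup (hμ : 0 < μ) (hu₀ : ContDiff ℝ ∞ u₀)
    (hdiv : NSWave0.IsDivFree u₀) (hdec : HasRapidSpatialDecay u₀) :
    ¬ clayR3.Solvable μ 0 u₀ ↔
      ∃ T : ℝ, 0 < T ∧
        ∃ (u : ℝ → EuclideanSpace ℝ (Fin 3) → EuclideanSpace ℝ (Fin 3))
          (p : ℝ → EuclideanSpace ℝ (Fin 3) → ℝ),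
          IsClassicalNSSolutionOn (Ico 0 T) μ 0 u p ∧ u 0 = u₀ ∧
          (∃ A : ℝ≥0∞, A < ⊤ ∧ ∀ t ∈ Ico 0 T, ∫⁻ x, ‖u t x‖ₑ ^ 2 ≤ A) ∧
          ∀ M : ℝ, ∃ t ∈ Ico 0 T, ∃ x, M < ‖u t x‖ := by
  constructor
  · intro hno
    rcases clayR3_solvable_or_supBlowup hμ hu₀ hdiv hdec with hsol | ⟨T, hT, u, p, hcl, hu0, hE, hb, -⟩
    · exact absurd hsol hno
    · exact ⟨T, hT, u, p, hcl, hu0, hE, hb⟩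
  · rintro ⟨T, -, u, p, hcl, hu0, hE, hb⟩
    exact not_clayR3_solvable_of_velocitySupCertificate hμ (hu₀.of_le (by norm_cast)) hdec hcl hu0
      hE hb

/-- **(A) at one viscosity ⇔ the a priori `L^∞` bound.** For `μ > 0`: `clayR3.RegularityAt μ` (every
smooth divergence-free datum of class (4) has a Clay-sense solution at viscosity `μ`) ⇔ every
classical solution of the unforced system on a half-open slab `[0, T) × ℝ³`, from a smooth
divergence-free datum of class (4), with finite energy on `[0, T)`, has BOUNDED velocity on
`[0, T) × ℝ³`. ((⇒) `exists_bounds_of_clayR3_solvable`; (⇐) `clayR3_solvable_or_supBlowup`.)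
[cite: FeffermanClay2006, (A) with (4) (6) (7) p. 2] [cite: Leray1934, §33] [cite: Tao2011, Conj. 1.3, Cor. 11.1, Cor. 11.4] -/
theorem clayR3_regularityAt_iff_aprioriBound (hμ : 0 < μ) :
    clayR3.RegularityAt μ ↔
      ∀ (u₀ : EuclideanSpace ℝ (Fin 3) → EuclideanSpace ℝ (Fin 3)), ContDiff ℝ ∞ u₀ →
        NSWave0.IsDivFree u₀ → HasRapidSpatialDecay u₀ →
        ∀ (T : ℝ) (u : ℝ → EuclideanSpace ℝ (Fin 3) → EuclideanSpace ℝ (Fin 3))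
          (p : ℝ → EuclideanSpace ℝ (Fin 3) → ℝ),
          IsClassicalNSSolutionOn (Ico 0 T) μ 0 u p → u 0 = u₀ →
          (∃ A : ℝ≥0∞, A < ⊤ ∧ ∀ t ∈ Ico 0 T, ∫⁻ x, ‖u t x‖ₑ ^ 2 ≤ A) →
            ∃ M : ℝ, ∀ t ∈ Ico 0 T, ∀ x, ‖u t x‖ ≤ M := by
  constructor
  · intro hreg u₀ hu₀ hdiv hdec T u p hcl hu0 hE
    obtain ⟨B, hB⟩ := exists_bounds_of_clayR3_solvable hμ (hu₀.of_le (by norm_cast)) hdec hcl hu0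
      hE (hreg u₀ hu₀ hdiv hdec) 0
    exact ⟨B, fun t ht x => by simpa using hB t ht x⟩
  · intro hbd u₀ hu₀ hdiv hdec
    rcases clayR3_solvable_or_supBlowup hμ hu₀ hdiv hdec with hsol | ⟨T, -, u, p, hcl, hu0, hE, hb, -⟩
    · exact hsol
    · obtain ⟨M, hM⟩ := hbd u₀ hu₀ hdiv hdec T u p hcl hu0 hE
      obtain ⟨t, ht, x, hMx⟩ := hb M
      exact absurd hMx (not_lt.2 (hM t ht x))

/-- **(A) ⇔ the a priori `L^∞` bound at every viscosity** (and, by `clayR3_regularityAt_iff`, at any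
single one). `clayR3.Regularity` is token-for-token the summit statement `NavierStokesRegularity`.
[cite: FeffermanClay2006, (A) with (4) (6) (7) p. 2] [cite: Leray1934, §33] [cite: Tao2011, Conj. 1.3, Cor. 11.1, Cor. 11.4] -/
theorem clayR3_regularity_iff_aprioriBound :
    clayR3.Regularity ↔
      ∀ μ : ℝ, 0 < μ →
      ∀ (u₀ : EuclideanSpace ℝ (Fin 3) → EuclideanSpace ℝ (Fin 3)), ContDiff ℝ ∞ u₀ →
        NSWave0.IsDivFree u₀ → HasRapidSpatialDecay u₀ →
        ∀ (T : ℝ) (u : ℝ → EuclideanSpace ℝ (Fin 3) → EuclideanSpace ℝ (Fin 3))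
          (p : ℝ → EuclideanSpace ℝ (Fin 3) → ℝ),
          IsClassicalNSSolutionOn (Ico 0 T) μ 0 u p → u 0 = u₀ →
          (∃ A : ℝ≥0∞, A < ⊤ ∧ ∀ t ∈ Ico 0 T, ∫⁻ x, ‖u t x‖ₑ ^ 2 ≤ A) →
            ∃ M : ℝ, ∀ t ∈ Ico 0 T, ∀ x, ‖u t x‖ ≤ M :=
  ⟨fun h μ hμ => (clayR3_regularityAt_iff_aprioriBound hμ).1 (h μ hμ),
    fun h μ hμ => (clayR3_regularityAt_iff_aprioriBound hμ).2 (h μ hμ)⟩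

/-- **(A) ⇔ the a priori `L^∞` bound at ONE viscosity `μ > 0`** (Δ7 scaling
`clayR3_regularityAt_iff`). [cite: FeffermanClay2006, (A) p. 2] [cite: Tao2013Localisation, Rem. 1.2 footnote] -/
theorem clayR3_regularity_iff_aprioriBound_at (hμ : 0 < μ) :
    clayR3.Regularity ↔
      ∀ (u₀ : EuclideanSpace ℝ (Fin 3) → EuclideanSpace ℝ (Fin 3)), ContDiff ℝ ∞ u₀ →
        NSWave0.IsDivFree u₀ → HasRapidSpatialDecay u₀ →
        ∀ (T : ℝ) (u : ℝ → EuclideanSpace ℝ (Fin 3) → EuclideanSpace ℝ (Fin 3))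
          (p : ℝ → EuclideanSpace ℝ (Fin 3) → ℝ),
          IsClassicalNSSolutionOn (Ico 0 T) μ 0 u p → u 0 = u₀ →
          (∃ A : ℝ≥0∞, A < ⊤ ∧ ∀ t ∈ Ico 0 T, ∫⁻ x, ‖u t x‖ₑ ^ 2 ≤ A) →
            ∃ M : ℝ, ∀ t ∈ Ico 0 T, ∀ x, ‖u t x‖ ≤ M := by
  rw [← clayR3_regularityAt_iff hμ]
  exact clayR3_regularityAt_iff_aprioriBound hμ

/-- **The unforced instance of (C) in blow-up form**: an unforced Clay Cauchy problem without
Clay-sense solution exists (some `μ > 0`, some datum of class (4)) ⇔ some finite-energy classical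
solution from a class-(4) datum blows up in sup norm in finite time (some `μ > 0`).
[cite: FeffermanClay2006, (C) with (4)–(7) p. 2] [cite: Leray1934, §33] [cite: Tao2011, Cor. 11.1, Cor. 11.4] -/
theorem exists_not_clayR3_solvable_iff_exists_supBlowup :
    (∃ μ : ℝ, 0 < μ ∧ ∃ u₀ : EuclideanSpace ℝ (Fin 3) → EuclideanSpace ℝ (Fin 3),
        ContDiff ℝ ∞ u₀ ∧ NSWave0.IsDivFree u₀ ∧ HasRapidSpatialDecay u₀ ∧
          ¬ clayR3.Solvable μ 0 u₀) ↔
      ∃ μ : ℝ, 0 < μ ∧ ∃ u₀ : EuclideanSpace ℝ (Fin 3) → EuclideanSpace ℝ (Fin 3),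
        ContDiff ℝ ∞ u₀ ∧ NSWave0.IsDivFree u₀ ∧ HasRapidSpatialDecay u₀ ∧
        ∃ T : ℝ, 0 < T ∧
          ∃ (u : ℝ → EuclideanSpace ℝ (Fin 3) → EuclideanSpace ℝ (Fin 3))
            (p : ℝ → EuclideanSpace ℝ (Fin 3) → ℝ),
            IsClassicalNSSolutionOn (Ico 0 T) μ 0 u p ∧ u 0 = u₀ ∧
            (∃ A : ℝ≥0∞, A < ⊤ ∧ ∀ t ∈ Ico 0 T, ∫⁻ x, ‖u t x‖ₑ ^ 2 ≤ A) ∧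
            ∀ M : ℝ, ∃ t ∈ Ico 0 T, ∃ x, M < ‖u t x‖ := by
  constructor
  · rintro ⟨μ, hμ, u₀, hu₀, hdiv, hdec, hno⟩
    exact ⟨μ, hμ, u₀, hu₀, hdiv, hdec,
      (not_clayR3_solvable_iff_exists_supBlowup hμ hu₀ hdiv hdec).1 hno⟩
  · rintro ⟨μ, hμ, u₀, hu₀, hdiv, hdec, hb⟩
    exact ⟨μ, hμ, u₀, hu₀, hdiv, hdec,
      (not_clayR3_solvable_iff_exists_supBlowup hμ hu₀ hdiv hdec).2 hb⟩

/-- **A finite-time sup-norm blow-up of one finite-energy classical solution from a class-(4) datum,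
at one viscosity, proves Clay (C)** (the `∃`-packaged form of
`navierStokesBreakdownR3_of_velocitySupCertificate`). [cite: FeffermanClay2006, (C) p. 2] [cite: Tao2011, Cor. 11.1, Cor. 11.4] -/
theorem navierStokesBreakdownR3_of_exists_supBlowup
    (h : ∃ μ : ℝ, 0 < μ ∧ ∃ u₀ : EuclideanSpace ℝ (Fin 3) → EuclideanSpace ℝ (Fin 3),
        ContDiff ℝ ∞ u₀ ∧ NSWave0.IsDivFree u₀ ∧ HasRapidSpatialDecay u₀ ∧
        ∃ T : ℝ, 0 < T ∧
          ∃ (u : ℝ → EuclideanSpace ℝ (Fin 3) → EuclideanSpace ℝ (Fin 3))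
            (p : ℝ → EuclideanSpace ℝ (Fin 3) → ℝ),
            IsClassicalNSSolutionOn (Ico 0 T) μ 0 u p ∧ u 0 = u₀ ∧
            (∃ A : ℝ≥0∞, A < ⊤ ∧ ∀ t ∈ Ico 0 T, ∫⁻ x, ‖u t x‖ₑ ^ 2 ≤ A) ∧
            ∀ M : ℝ, ∃ t ∈ Ico 0 T, ∃ x, M < ‖u t x‖) :
    Summit.NavierStokesRegularity.NavierStokesRegularity.NavierStokesBreakdownR3 := by
  obtain ⟨μ, hμ, u₀, hu₀, hdiv, hdec, T, -, u, p, hcl, hu0, hE, hb⟩ := h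
  exact navierStokesBreakdownR3_of_velocitySupCertificate hμ hu₀ hdiv hdec hcl hu0 hE hb

/-- **If (A) fails, it fails through a finite-time sup-norm blow-up**: `¬ clayR3.Regularity` ⇒ some
finite-energy classical solution from a class-(4) datum has unbounded velocity on a half-open slab
(so every disproof of (A) in the unforced class can be presented as such a certificate).
[cite: FeffermanClay2006, (A) (C) p. 2] [cite: Leray1934, §33] [cite: Tao2011, Cor. 11.1, Cor. 11.4] -/
theorem exists_supBlowup_of_not_clayR3_regularity (h : ¬ clayR3.Regularity) :
    ∃ μ : ℝ, 0 < μ ∧ ∃ u₀ : EuclideanSpace ℝ (Fin 3) → EuclideanSpace ℝ (Fin 3),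
      ContDiff ℝ ∞ u₀ ∧ NSWave0.IsDivFree u₀ ∧ HasRapidSpatialDecay u₀ ∧
      ∃ T : ℝ, 0 < T ∧
        ∃ (u : ℝ → EuclideanSpace ℝ (Fin 3) → EuclideanSpace ℝ (Fin 3))
          (p : ℝ → EuclideanSpace ℝ (Fin 3) → ℝ),
          IsClassicalNSSolutionOn (Ico 0 T) μ 0 u p ∧ u 0 = u₀ ∧
          (∃ A : ℝ≥0∞, A < ⊤ ∧ ∀ t ∈ Ico 0 T, ∫⁻ x, ‖u t x‖ₑ ^ 2 ≤ A) ∧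
          ∀ M : ℝ, ∃ t ∈ Ico 0 T, ∃ x, M < ‖u t x‖ := by
  unfold ClaySpec.Regularity ClaySpec.RegularityAt at h
  push Not at h
  obtain ⟨μ, hμ, u₀, hu₀, hdiv, hdec, hno⟩ := h
  exact exists_not_clayR3_solvable_iff_exists_supBlowup.1 ⟨μ, hμ, u₀, hu₀, hdiv, hdec, hno⟩

end

end Literature.Claims.NS.ClayVariants

-- WHAT THIS IS NOT: not a claim about NS regularity or blow-up; not a claim about any author beyond
-- the typed locator.
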